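import Summits.AtomisticToContinuum.HydrodynamicLimit.Theorems.ImplosionDichotomyPolynomialCompressionSolutionAPI
import Literature.Analysis.FunctionSpaces.TorusCalculusProofs
import Literature.Analysis.FunctionSpaces.TorusSpaceTime
import Mathlib.Analysis.ODE.Gronwall

/-!
# Grönwall uniqueness shell on the flat torus (energy method, abstract form)

Helper file for the line `log-lipschitz-budget` of the crux
`ImplosionDichotomy.PolynomialCompression` (stub `stub_conditionalExistence`, component (c):
uniqueness of classical hard-sphere–Euler solutions). The uniqueness proof is the classical
`L²`/relative-energy argument on `𝕋³` (no boundary, no cone): an energy density `e ≥ 0` built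
from the difference of two solutions, fluxes `Φᵢ`, a pointwise balance
`∂ₜe + Σᵢ ∂ᵢΦᵢ ≤ C e` on every compact time slab, and `e(0, ·) = 0` force `e ≡ 0`. This file
proves that ABSTRACT shell once and for all, for jointly smooth space–time fields on `[0, T) × 𝕋³`
in the torus calculus of `TorusCalculus`/`TorusSpaceTime` (one-sided time derivatives within
`[0, T)`), together with the elementary compactness tools the PDE part uses:

* `torus_energy_eq_zero_of_balance` — the shell (divergence theorem on `𝕋³`, differentiation
  under `∫`, the one-sided Grönwall inequality `le_gronwallBound_of_liminf_deriv_right_le`, and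
  "continuous, nonnegative, integral zero ⟹ zero");
* `exists_forall_abs_le_of_isSmoothSpaceTimeOn` / `exists_pos_le_of_isSmoothSpaceTimeOn` — uniform
  upper bounds of finitely many jointly smooth scalar fields, and uniform positive lower bounds of
  positive jointly smooth fields, on compact time slabs `[0, t₁] ⊆ [0, T)`;
* `abs_sum_mul_mul_le` — the bilinear absorption `|Σ cₖ aₖ bₖ| ≤ K Σ (aₖ² + bₖ²)`.
-/

noncomputable section

namespace Summit.AtomisticToContinuum.HydrodynamicLimit.Theorems

open Set Filter Topology MeasureTheory
open Literature.MathematicalPhysics.KineticTheory Literature.Analysis.FunctionSpaces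

/-! ### Scalar one-sided Grönwall: `φ' ≤ K φ`, `φ(0) = 0`, `φ ≥ 0` force `φ = 0` -/

/-- One-sided Grönwall uniqueness on `[0, t₁]`: a function continuous on `[0, t₁]`, with right
derivative `φ' s ≤ K φ s` at every `s ∈ [0, t₁)`, `φ 0 = 0` and `φ ≥ 0`, vanishes on `[0, t₁]`
(Mathlib `le_gronwallBound_of_liminf_deriv_right_le` with `δ = ε = 0`). [folklore] -/
theorem eq_zero_of_deriv_right_le_mul_self {φ φ' : ℝ → ℝ} {K t₁ : ℝ}
    (hcont : ContinuousOn φ (Icc 0 t₁))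
    (hderiv : ∀ s ∈ Ico 0 t₁, HasDerivWithinAt φ (φ' s) (Ici s) s)
    (h0 : φ 0 = 0) (hnonneg : ∀ s ∈ Icc 0 t₁, 0 ≤ φ s)
    (hbound : ∀ s ∈ Ico 0 t₁, φ' s ≤ K * φ s) : ∀ s ∈ Icc 0 t₁, φ s = 0 := by
  have hle := le_gronwallBound_of_liminf_deriv_right_le (f := φ) (f' := φ') (δ := 0) (K := K)
    (ε := 0) (a := 0) (b := t₁) hcont (fun s hs r hr => ?_) h0.le (fun s hs => by
      simpa using hbound s hs)
  · intro s hs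
    have h := hle s hs
    rw [gronwallBound_ε0_δ0] at h
    exact le_antisymm h (hnonneg s hs)
  · refine ((hderiv s hs).liminf_right_slope_le hr).mono fun z hz => ?_
    rwa [slope_def_field, div_eq_inv_mul] at hz

/-! ### Uniform bounds of jointly smooth fields on compact time slabs -/

/-- A jointly smooth scalar field on `[0, T) × 𝕋³` is bounded in absolute value on
`[0, t₁] × 𝕋³` for every `t₁ < T`. [folklore] -/
theorem exists_abs_le_of_isSmoothSpaceTimeOn {T t₁ : ℝ} {f : ℝ → T3 → ℝ}
    (hf : Torus.IsSmoothSpaceTimeOn (Ico 0 T) f) (ht₁ : t₁ < T) :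
    ∃ K, 0 ≤ K ∧ ∀ t ∈ Icc 0 t₁, ∀ x, |f t x| ≤ K := by
  obtain ⟨K, hK⟩ := hf.exists_norm_le_of_isCompact isCompact_Icc (Icc_subset_Ico_right ht₁)
  refine ⟨max K 0, le_max_right _ _, fun t ht x => ?_⟩
  rw [← Real.norm_eq_abs]
  exact (hK t ht x).trans (le_max_left _ _)

/-- Finitely many jointly smooth scalar fields on `[0, T) × 𝕋³` admit a common bound on
`[0, t₁] × 𝕋³`, `t₁ < T`. [folklore] -/
theorem exists_forall_abs_le_of_isSmoothSpaceTimeOn {ι : Type*} [Fintype ι] {T t₁ : ℝ}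
    {f : ι → ℝ → T3 → ℝ} (hf : ∀ k, Torus.IsSmoothSpaceTimeOn (Ico 0 T) (f k)) (ht₁ : t₁ < T) :
    ∃ K, 0 ≤ K ∧ ∀ k, ∀ t ∈ Icc 0 t₁, ∀ x, |f k t x| ≤ K := by
  choose K hK0 hK using fun k => exists_abs_le_of_isSmoothSpaceTimeOn (hf k) ht₁
  refine ⟨∑ k, K k, Finset.sum_nonneg fun k _ => hK0 k, fun k t ht x => ?_⟩
  exact (hK k t ht x).trans (Finset.single_le_sum (fun j _ => hK0 j) (Finset.mem_univ k))

/-- A positive jointly smooth scalar field on `[0, T) × 𝕋³` is bounded below by a positive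
constant on `[0, t₁] × 𝕋³`, `t₁ < T` (its inverse is jointly smooth, hence bounded). [folklore] -/
theorem exists_pos_le_of_isSmoothSpaceTimeOn {T t₁ : ℝ} {f : ℝ → T3 → ℝ}
    (hf : Torus.IsSmoothSpaceTimeOn (Ico 0 T) f) (hpos : ∀ t ∈ Ico 0 T, ∀ x, 0 < f t x)
    (ht₁ : t₁ < T) : ∃ c, 0 < c ∧ ∀ t ∈ Icc 0 t₁, ∀ x, c ≤ f t x := by
  have hinv : Torus.IsSmoothSpaceTimeOn (Ico 0 T) (fun t x => (f t x)⁻¹) := by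
    refine ContDiffOn.inv hf ?_
    rintro ⟨t, y⟩ hp
    exact (hpos t (mem_prod.1 hp).1 _).ne'
  obtain ⟨K, hK0, hK⟩ := exists_abs_le_of_isSmoothSpaceTimeOn hinv ht₁
  refine ⟨(K + 1)⁻¹, by positivity, fun t ht x => ?_⟩
  have hft : 0 < f t x := hpos t ⟨ht.1, ht.2.trans_lt ht₁⟩ x
  have h1 : (f t x)⁻¹ ≤ K + 1 := ((le_abs_self _).trans (hK t ht x)).trans (by linarith)
  rw [inv_le_comm₀ (by positivity) hft]
  exact h1

/-! ### Bilinear absorption -/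

/-- `|Σₖ cₖ aₖ bₖ| ≤ K Σₖ (aₖ² + bₖ²)` when `|cₖ| ≤ K` (`2|ab| ≤ a² + b²`). [folklore] -/
theorem abs_sum_mul_mul_le {ι : Type*} (s : Finset ι) {c a b : ι → ℝ} {K : ℝ}
    (hc : ∀ k ∈ s, |c k| ≤ K) :
    |∑ k ∈ s, c k * a k * b k| ≤ K * ∑ k ∈ s, (a k ^ 2 + b k ^ 2) := by
  rw [Finset.mul_sum]
  refine (Finset.abs_sum_le_sum_abs _ _).trans (Finset.sum_le_sum fun k hk => ?_)
  rw [abs_mul, abs_mul]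
  have hK : 0 ≤ K := (abs_nonneg _).trans (hc k hk)
  have hab : |a k| * |b k| ≤ a k ^ 2 + b k ^ 2 := by
    nlinarith [sq_nonneg (|a k| - |b k|), sq_abs (a k), sq_abs (b k), abs_nonneg (a k),
      abs_nonneg (b k)]
  calc |c k| * |a k| * |b k| = |c k| * (|a k| * |b k|) := by ring
    _ ≤ K * (a k ^ 2 + b k ^ 2) :=
      mul_le_mul (hc k hk) hab (mul_nonneg (abs_nonneg _) (abs_nonneg _)) hK

/-! ### Continuous nonnegative functions on `𝕋³` with zero integral vanish -/

/-- A continuous nonnegative function on `𝕋³` with integral zero vanishes identically (the Haar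
probability measure of `𝕋³` charges open sets). [folklore] -/
theorem eq_zero_of_integral_eq_zero_of_nonneg {g : T3 → ℝ} (hg : Continuous g)
    (hnonneg : ∀ x, 0 ≤ g x) (hint : ∫ x, g x = 0) : ∀ x, g x = 0 := by
  have hae : g =ᵐ[volume] 0 :=
    (integral_eq_zero_iff_of_nonneg (fun x => hnonneg x) hg.integrable_unitAddTorus).1 hint
  have heq : g = 0 := (Continuous.ae_eq_iff_eq volume hg continuous_const).1 hae
  exact fun x => congrFun heq x

/-! ### The Grönwall shell on `[0, T) × 𝕋³` -/

/-- **Energy method on the torus, abstract shell.** Let `e` (energy density) and `Φ₀, Φ₁, Φ₂`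
(fluxes) be jointly smooth scalar fields on `[0, T) × 𝕋³` with `e ≥ 0`, `e(0, ·) = 0`, and the
pointwise balance `∂ₜe + Σᵢ ∂ᵢΦᵢ ≤ C e` on `[0, t₁] × 𝕋³` for every `t₁ < T` (a constant `C`
depending on `t₁`; `∂ₜ` one-sided within `[0, T)`). Then `e ≡ 0` on `[0, T) × 𝕋³`: the total
energy `E(t) = ∫ e(t, x) dx` has one-sided derivative `∫ ∂ₜe = ∫ (∂ₜe + Σᵢ∂ᵢΦᵢ) ≤ C E`
(divergence theorem on `𝕋³`, differentiation under `∫`), `E(0) = 0`, `E ≥ 0`, so `E ≡ 0` by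
Grönwall, and a continuous nonnegative slice with zero integral vanishes. [folklore] -/
theorem torus_energy_eq_zero_of_balance :
    ∀ {T : ℝ} {e : ℝ → T3 → ℝ} {Φ : Fin 3 → ℝ → T3 → ℝ},
      Torus.IsSmoothSpaceTimeOn (Ico 0 T) e → (∀ i, Torus.IsSmoothSpaceTimeOn (Ico 0 T) (Φ i)) →
      (∀ t ∈ Ico 0 T, ∀ x, 0 ≤ e t x) → (∀ x, e 0 x = 0) →
      (∀ t₁ ∈ Ico 0 T, ∃ C : ℝ, ∀ t ∈ Icc 0 t₁, ∀ x,
        Torus.timeDerivWithin (Ico 0 T) e t x + ∑ i, Torus.partialDeriv i (Φ i t) x ≤ C * e t x) →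
      ∀ t ∈ Ico 0 T, ∀ x, e t x = 0 := by
  intro T e Φ he hΦ hnonneg hinit hbal t₁ ht₁
  have hT : (0 : ℝ) < T := ht₁.1.trans_lt ht₁.2
  have hU : UniqueDiffOn ℝ (Ico (0 : ℝ) T) := uniqueDiffOn_Ico 0 T
  obtain ⟨C, hC⟩ := hbal t₁ ht₁
  -- the total energy and its one-sided derivative
  set E : ℝ → ℝ := fun t => ∫ x, e t x with hE
  have hderiv : ∀ s ∈ Ico 0 T, HasDerivWithinAt E
      (∫ x, Torus.timeDerivWithin (Ico 0 T) e s x) (Ico 0 T) s :=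
    fun s hs => he.hasDerivWithinAt_integral (convex_Ico 0 T) hs
  -- `∫ ∂ₜe = ∫ (∂ₜe + div Φ) ≤ C E` on `[0, t₁]`
  have hflux : ∀ s ∈ Ico 0 T, ∫ x, ∑ i, Torus.partialDeriv i (Φ i s) x = 0 := by
    intro s hs
    rw [integral_finsetSum _ fun i _ => (((hΦ i).isSmooth_slice hs).partialDeriv i).integrable]
    exact Finset.sum_eq_zero fun i _ =>
      Torus.integral_partialDeriv_eq_zero_holds ((hΦ i).isSmooth_slice hs) i
  have hle : ∀ s ∈ Ico 0 t₁, ∫ x, Torus.timeDerivWithin (Ico 0 T) e s x ≤ C * E s := by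
    intro s hs
    have hsT : s ∈ Ico 0 T := ⟨hs.1, hs.2.trans ht₁.2⟩
    have hi1 : Integrable (Torus.timeDerivWithin (Ico 0 T) e s) volume :=
      (he.isSmooth_timeDerivWithin hU hsT).integrable
    have hi2 : Integrable (fun x => ∑ i, Torus.partialDeriv i (Φ i s) x) volume :=
      integrable_finsetSum _ fun i _ => (((hΦ i).isSmooth_slice hsT).partialDeriv i).integrable
    have hi3 : Integrable (fun x => C * e s x) volume := ((he.isSmooth_slice hsT).integrable).const_mul C
    calc ∫ x, Torus.timeDerivWithin (Ico 0 T) e s x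
        = ∫ x, (Torus.timeDerivWithin (Ico 0 T) e s x + ∑ i, Torus.partialDeriv i (Φ i s) x) := by
          rw [integral_add hi1 hi2, hflux s hsT, add_zero]
      _ ≤ ∫ x, C * e s x := integral_mono (hi1.add hi2) hi3 fun x => hC s (Ico_subset_Icc_self hs) x
      _ = C * E s := integral_const_mul C _
  -- Grönwall on `[0, t₁]`
  have hcont : ContinuousOn E (Icc 0 t₁) := fun s hs =>
    ((hderiv s ⟨hs.1, hs.2.trans_lt ht₁.2⟩).continuousWithinAt).mono (Icc_subset_Ico_right ht₁.2)
  have hright : ∀ s ∈ Ico 0 t₁,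
      HasDerivWithinAt E (∫ x, Torus.timeDerivWithin (Ico 0 T) e s x) (Ici s) s := by
    intro s hs
    have hsT : s ∈ Ico 0 T := ⟨hs.1, hs.2.trans ht₁.2⟩
    exact (hderiv s hsT).mono_of_mem_nhdsWithin
      (Filter.mem_of_superset (Ico_mem_nhdsGE hsT.2) (Ico_subset_Ico_left hsT.1))
  have hE0 : E 0 = 0 := by
    simp only [hE]
    exact integral_eq_zero_of_ae (Eventually.of_forall hinit)
  have hEnonneg : ∀ s ∈ Icc 0 t₁, 0 ≤ E s := fun s hs =>
    integral_nonneg fun x => hnonneg s ⟨hs.1, hs.2.trans_lt ht₁.2⟩ x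
  have hEzero := eq_zero_of_deriv_right_le_mul_self hcont hright hE0 hEnonneg hle t₁
    (right_mem_Icc.2 ht₁.1)
  -- a continuous nonnegative slice with zero integral vanishes
  exact eq_zero_of_integral_eq_zero_of_nonneg (he.isSmooth_slice ht₁).continuous
    (fun x => hnonneg t₁ ht₁ x) hEzero

end Summit.AtomisticToContinuum.HydrodynamicLimit.Theorems

end
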